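import Summits.Parity.GeneralizedHardyLittlewood.Theses.LiouvilleShiftedTables
import Literature.NumberTheory.Sieve.BombieriVinogradovLiouvilleHeights

/-!
# `BVLiouville` — Bombieri–Vinogradov for the Liouville function, all residues, level `x^{1/2−ε}`

Route `LiouvilleShiftedTables` (Parity / GeneralizedHardyLittlewood), support item stmt-Parity-13324
(`Summit.Parity.GeneralizedHardyLittlewood.Theses.LiouvilleShiftedTables.BVLiouville`), which is also the
registered stub `stub_bvLiouville` of line `peel-to-drappeau` for the crux `TypeI2Dilated`
(stmt-Parity-14272).

Proof (`BVLiouville_proof`): a residue `c_d` with `g = (c_d, d)` reduces to the coprime residue `c_d/g`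
modulo `d' = d/g` by complete multiplicativity (`|λ(g)| = 1`), and `∑_{n ≤ N} λ(d'n + c')` is the `λ`-sum
over the class `c' (mod d')` up to the height `d'N + c' ≤ 2x/g`, up to a boundary term `≤ 1`
(`Literature.NumberTheory.Sieve.BVLiouvilleHeights.term_le`).  Grouping the moduli
`d ≤ D = ⌊x^{1/2−ε}⌋` by `g` (for fixed `g` the map `d ↦ d/g` is injective into `[1, D/g]`, and
`D/g ≤ (2x/g)^{1/2}(log(2x/g))^{−B}` once `(log 2x)^B ≤ x^ε`), one application of the per-modulus-height
Bombieri–Vinogradov theorem for `λ` in reduced classes (`Literature.NumberTheory.Sieve.BVLiouvilleHeights.bv_liouvilleAP`) at scale `2x/g`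
for each `g` and the harmonic sum over `g` give `C x (log x)^{−A}`.
-/

open Finset Real

noncomputable section

namespace Summit.Parity.GeneralizedHardyLittlewood.Cruxes.TypeI2Dilated.PeelToDrappeau

open ArithmeticFunction Literature.NumberTheory.Sieve Literature.NumberTheory.Sieve.BVMoebius
open scoped ArithmeticFunction.Moebius
open Literature.NumberTheory.Sieve.FTLiouville (inner_progression_eq card_filter_natCast_eq_le)
open Literature.NumberTheory.LFunctions (SiegelWalfiszMoebius_holds)
open Literature.NumberTheory.LFunctions.SiegelWalfiszLiouville (sum_liouville_progression_eq
  filter_isSquare_Ioc_eq_image sum_Ioc_inv_sq_le)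
open Literature.NumberTheory.LFunctions.LiouvilleSum (abs_liouville_le_one)
open Summit.Parity.GeneralizedHardyLittlewood.Theses.LiouvilleShiftedTables (BVLiouville)
open Literature.NumberTheory.Sieve.BVLiouvilleHeights

/-! ### The route item -/

set_option maxHeartbeats 1600000 in
/-- **Bombieri–Vinogradov for `λ`, all residues, one height per modulus, level `x^{1/2−ε}`** — the route
item `BVLiouville` (stmt-Parity-13324): reduce the residue `c_d` to the coprime residue `c_d/g` modulo
`d/g` (`g = (c_d, d)`), group the moduli by `g`, and apply `bv_liouvilleAP` at scale `2x/g` for each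
`g`. [folklore; cite: FouvryTenenbaum2021, Theorem 1.8] -/
theorem BVLiouville_proof : BVLiouville := by
  intro ε hε A hA
  obtain ⟨B, Ch, x₀, hB, hCh, hBVl⟩ := bv_liouvilleAP (A + 1) (by positivity)
  have hlev : ∀ᶠ x : ℝ in Filter.atTop, Real.log (2 * x) ^ B ≤ x ^ ε := by
    have h2 : Filter.Tendsto (fun x : ℝ => 2 * x) Filter.atTop Filter.atTop :=
      Filter.tendsto_id.const_mul_atTop two_pos
    filter_upwards [h2.eventually (eventually_log_rpow_le_rpow' B (half_pos hε)),
      Filter.eventually_ge_atTop (2 : ℝ)] with x hx hx2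
    have hx0 : 0 < x := by linarith
    calc Real.log (2 * x) ^ B ≤ (2 * x) ^ (ε / 2) := hx
      _ ≤ (x * x) ^ (ε / 2) := Real.rpow_le_rpow (by positivity) (by nlinarith) (by positivity)
      _ = x ^ ε := by rw [Real.mul_rpow hx0.le hx0.le, ← Real.rpow_add hx0, add_halves]
  obtain ⟨x₁, hx₁⟩ := Filter.eventually_atTop.1 ((Filter.eventually_ge_atTop (2 : ℝ)).and
    ((Real.tendsto_log_atTop.eventually_ge_atTop (1 : ℝ)).and
    ((((tendsto_rpow_atTop (by norm_num : (0 : ℝ) < 1 / 2)).eventually_ge_atTop x₀).and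
    (hlev.and (eventually_log_rpow_le_rpow' A (by positivity : (0 : ℝ) < 2 * ε)))))))
  refine ⟨4 * 2 ^ (A + 1) * Ch + 1, x₁, fun x hx c y hc hy => ?_⟩
  obtain ⟨hx2, hL1, hx₀, hlevx, hbd⟩ := hx₁ x hx
  have hx0 : 0 < x := by linarith
  have hx1 : 1 ≤ x := by linarith
  set L := Real.log x with hLdef
  have hL0 : 0 < L := by linarith
  have hLA1 : L ^ (A + 1) = L ^ A * L := by rw [Real.rpow_add hL0, Real.rpow_one]
  set D := ⌊x ^ (1 / 2 - ε)⌋₊ with hDdef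
  have hDle : (D : ℝ) ≤ x ^ (1 / 2 - ε) := Nat.floor_le (by positivity)
  have hDhalf : (D : ℝ) ≤ x ^ (1 / 2 : ℝ) :=
    hDle.trans (Real.rpow_le_rpow_of_exponent_le hx1 (by linarith))
  have hDx : (D : ℝ) ≤ x := hDle.trans (by
    simpa only [Real.rpow_one] using Real.rpow_le_rpow_of_exponent_le hx1 (by linarith : 1 / 2 - ε ≤ 1))
  have hsqx : x ^ (1 / 2 : ℝ) * x ^ (1 / 2 : ℝ) = x := by rw [← Real.rpow_add hx0]; norm_num
  set cn : ℕ → ℕ := fun d => (c d).toNat with hcn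
  set G : ℕ → ℕ := fun d => Nat.gcd (cn d) d with hG
  set T : ℕ → ℝ := fun d =>
    |∑ n ∈ Icc 1 ⌊y d / d⌋₊, (liouville (Int.toNat ((d : ℤ) * n + c d)) : ℝ)| with hT
  show ∑ d ∈ Icc 1 D, T d ≤ _
  have hGmem : ∀ d ∈ Icc 1 D, G d ∈ Icc 1 D := by
    intro d hd
    obtain ⟨hd1, hdD⟩ := mem_Icc.1 hd
    exact mem_Icc.2 ⟨Nat.gcd_pos_of_pos_right _ hd1, (Nat.gcd_le_right _ hd1).trans hdD⟩
  rw [← sum_fiberwise_of_maps_to hGmem]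
  -- the bound on the fibre of `g`
  have hfib : ∀ g ∈ Icc 1 D, ∑ d ∈ (Icc 1 D).filter (fun d => G d = g), T d ≤
      Ch * 2 ^ (A + 1) * (2 * x / g) / L ^ (A + 1) + D := by
    intro g hg
    obtain ⟨hg1, hgD⟩ := mem_Icc.1 hg
    have hg0 : (0 : ℝ) < g := by exact_mod_cast hg1
    have hg1' : (1 : ℝ) ≤ g := by exact_mod_cast hg1
    have hgx : (g : ℝ) ≤ x := le_trans (by exact_mod_cast hgD) hDx
    have hgle : (g : ℝ) ≤ x ^ (1 / 2 : ℝ) := le_trans (by exact_mod_cast hgD) hDhalf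
    set X : ℝ := 2 * x / g with hXdef
    set Qg : ℕ := D / g with hQgdef
    have hXhalf : x ^ (1 / 2 : ℝ) ≤ X := by
      rw [hXdef, le_div_iff₀ hg0]
      calc x ^ (1 / 2 : ℝ) * g ≤ x ^ (1 / 2 : ℝ) * x ^ (1 / 2 : ℝ) :=
            mul_le_mul_of_nonneg_left hgle (by positivity)
        _ = x := hsqx
        _ ≤ 2 * x := by linarith
    have hx₀X : x₀ ≤ X := hx₀.trans hXhalf
    have hX2 : 2 ≤ X := by rw [hXdef, le_div_iff₀ hg0]; linarith
    have hXpos : 0 < X := by linarith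
    have hlogX : L / 2 ≤ Real.log X := by
      have h := Real.log_le_log (by positivity) hXhalf
      rwa [Real.log_rpow hx0, show (1 / 2 : ℝ) * Real.log x = L / 2 by rw [hLdef]; ring] at h
    have hlogX0 : 0 < Real.log X := by linarith
    have hlogXle : Real.log X ≤ Real.log (2 * x) :=
      Real.log_le_log hXpos (div_le_self (by positivity) hg1')
    have hxg : x / g + x / g = X := by rw [hXdef]; ring
    -- data for `bv_liouvilleAP` on the fibre
    set Nb : ℕ → ℕ := fun d' => if d' ∈ Icc 1 Qg ∧ G (g * d') = g then
      d' * ⌊y (g * d') / ((g * d' : ℕ) : ℝ)⌋₊ + cn (g * d') / g else 0 with hNb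
    set ab : (d' : ℕ) → ZMod d' := fun d' => if d' ∈ Icc 1 Qg ∧ G (g * d') = g then
      ((cn (g * d') / g : ℕ) : ZMod d') else 1 with hab
    have hQg : (Qg : ℝ) ≤ X ^ (1 / 2 : ℝ) / Real.log X ^ B := by
      have hlogXB : Real.log X ^ B ≤ x ^ ε := (Real.rpow_le_rpow hlogX0.le hlogXle hB.le).trans hlevx
      have hsqrt : x ^ (1 / 2 : ℝ) / g ≤ X ^ (1 / 2 : ℝ) := by
        calc x ^ (1 / 2 : ℝ) / g = Real.sqrt x / g := by rw [Real.sqrt_eq_rpow]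
          _ = Real.sqrt (x / (g : ℝ) ^ 2) := by rw [Real.sqrt_div hx0.le, Real.sqrt_sq hg0.le]
          _ ≤ Real.sqrt X := Real.sqrt_le_sqrt (by
              rw [hXdef, div_le_div_iff₀ (by positivity) hg0]
              have h := mul_le_mul_of_nonneg_left hg1' (by positivity : (0 : ℝ) ≤ x * g)
              nlinarith [mul_nonneg hx0.le hg0.le])
          _ = X ^ (1 / 2 : ℝ) := Real.sqrt_eq_rpow X
      calc (Qg : ℝ) ≤ (D : ℝ) / g := Nat.cast_div_le
        _ ≤ x ^ (1 / 2 - ε) / g := div_le_div_of_nonneg_right hDle hg0.le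
        _ = x ^ (1 / 2 : ℝ) / g / x ^ ε := by rw [Real.rpow_sub hx0, div_right_comm]
        _ ≤ X ^ (1 / 2 : ℝ) / Real.log X ^ B :=
            div_le_div₀ (by positivity) hsqrt (Real.rpow_pos_of_pos hlogX0 B) hlogXB
    have hNbX : ∀ d', (Nb d' : ℝ) ≤ X := by
      intro d'
      simp only [hNb]
      split_ifs with hP
      · obtain ⟨hd'mem, hGdd⟩ := hP
        obtain ⟨hd'1, hd'Q⟩ := mem_Icc.1 hd'mem
        have hdd1 : 1 ≤ g * d' := le_trans hg1 (Nat.le_mul_of_pos_right g hd'1)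
        have hdd0 : (0 : ℝ) < ((g * d' : ℕ) : ℝ) := by exact_mod_cast hdd1
        obtain ⟨_, hcd⟩ := hc (g * d') hdd1
        have hy' := hy (g * d')
        have h1 : ((d' * ⌊y (g * d') / ((g * d' : ℕ) : ℝ)⌋₊ : ℕ) : ℝ) ≤ x / g := by
          push_cast
          calc (d' : ℝ) * (⌊y (g * d') / ((g : ℝ) * d')⌋₊ : ℝ)
              ≤ d' * (y (g * d') / ((g : ℝ) * d')) := by
                refine mul_le_mul_of_nonneg_left (Nat.floor_le (div_nonneg hy'.1 ?_)) (Nat.cast_nonneg _)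
                push_cast at hdd0; exact hdd0.le
            _ = y (g * d') / g := by
                have hd'0 : (d' : ℝ) ≠ 0 := by exact_mod_cast (show d' ≠ 0 by omega)
                field_simp
            _ ≤ x / g := div_le_div_of_nonneg_right hy'.2 hg0.le
        have h2 : ((cn (g * d') / g : ℕ) : ℝ) ≤ x / g := by
          have hlt : cn (g * d') / g < g * d' / g := toNat_div_lt hdd1 hcd hGdd
          rw [Nat.mul_div_cancel_left d' hg1] at hlt
          calc ((cn (g * d') / g : ℕ) : ℝ) ≤ (Qg : ℝ) := by exact_mod_cast hlt.le.trans hd'Q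
            _ ≤ (D : ℝ) / g := Nat.cast_div_le
            _ ≤ x / g := div_le_div_of_nonneg_right hDx hg0.le
        rw [Nat.cast_add]
        linarith
      · rw [Nat.cast_zero]; exact hXpos.le
    have habu : ∀ d' ∈ Icc 1 Qg, IsUnit (ab d') := by
      intro d' hd'
      simp only [hab]
      split_ifs with hP
      · obtain ⟨hd'mem, hGdd⟩ := hP
        obtain ⟨hd'1, _⟩ := mem_Icc.1 hd'mem
        have hdd1 : 1 ≤ g * d' := le_trans hg1 (Nat.le_mul_of_pos_right g hd'1)
        have hcop : Nat.Coprime (cn (g * d') / g) d' := by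
          have h := Nat.coprime_div_gcd_div_gcd (m := cn (g * d')) (n := g * d')
            (Nat.gcd_pos_of_pos_right _ hdd1)
          have hGdd' : Nat.gcd (cn (g * d')) (g * d') = g := hGdd
          rwa [hGdd', Nat.mul_div_cancel_left d' hg1] at h
        exact (ZMod.isUnit_iff_coprime _ _).2 hcop
      · exact isUnit_one
    have hBVg := hBVl X hx₀X Qg hQg Nb hNbX ab habu
    -- each term of the fibre is a term of the Bombieri–Vinogradov sum, plus `1`
    have hW : ∀ d ∈ (Icc 1 D).filter (fun d => G d = g), T d ≤
        |∑ m ∈ (Icc 1 (Nb (d / g))).filter (fun m : ℕ => (m : ZMod (d / g)) = ab (d / g)),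
          (liouville m : ℝ)| + 1 := by
      intro d hd
      obtain ⟨hdmem, hGd⟩ := mem_filter.1 hd
      obtain ⟨hd1, hdD⟩ := mem_Icc.1 hdmem
      have hgd : g ∣ d := hGd ▸ Nat.gcd_dvd_right _ _
      have hgd' : g * (d / g) = d := Nat.mul_div_cancel' hgd
      have hP : d / g ∈ Icc 1 Qg ∧ G (g * (d / g)) = g :=
        ⟨mem_Icc.2 ⟨Nat.div_pos (Nat.le_of_dvd (by omega) hgd) hg1, Nat.div_le_div_right hdD⟩,
          by rw [hgd']; exact hGd⟩
      have hNbd : Nb (d / g) = d / g * ⌊y d / d⌋₊ + cn d / g := by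
        simp only [hNb]; rw [if_pos hP, hgd']
      have habd : ab (d / g) = ((cn d / g : ℕ) : ZMod (d / g)) := by
        simp only [hab]; rw [if_pos hP, hgd']
      rw [hNbd, habd]
      obtain ⟨hc0, hcd⟩ := hc d hd1
      exact term_le hd1 hc0 hcd hGd (y d)
    calc ∑ d ∈ (Icc 1 D).filter (fun d => G d = g), T d
        ≤ ∑ d ∈ (Icc 1 D).filter (fun d => G d = g),
            (|∑ m ∈ (Icc 1 (Nb (d / g))).filter (fun m : ℕ => (m : ZMod (d / g)) = ab (d / g)),
              (liouville m : ℝ)| + 1) := sum_le_sum hW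
      _ = ∑ d' ∈ ((Icc 1 D).filter (fun d => G d = g)).image (fun d => d / g),
            (|∑ m ∈ (Icc 1 (Nb d')).filter (fun m : ℕ => (m : ZMod d') = ab d'),
              (liouville m : ℝ)| + 1) := by
          rw [sum_image]
          intro d₁ hd₁ d₂ hd₂ h
          have h1 : g ∣ d₁ := (mem_filter.1 hd₁).2 ▸ Nat.gcd_dvd_right _ _
          have h2 : g ∣ d₂ := (mem_filter.1 hd₂).2 ▸ Nat.gcd_dvd_right _ _
          calc d₁ = g * (d₁ / g) := (Nat.mul_div_cancel' h1).symm
            _ = g * (d₂ / g) := by rw [show d₁ / g = d₂ / g from h]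
            _ = d₂ := Nat.mul_div_cancel' h2
      _ ≤ ∑ d' ∈ Icc 1 Qg, (|∑ m ∈ (Icc 1 (Nb d')).filter (fun m : ℕ => (m : ZMod d') = ab d'),
              (liouville m : ℝ)| + 1) := by
          refine sum_le_sum_of_subset_of_nonneg (fun d' hd' => ?_) fun _ _ _ => by positivity
          obtain ⟨d, hd, rfl⟩ := mem_image.1 hd'
          obtain ⟨hdmem, hGd⟩ := mem_filter.1 hd
          obtain ⟨hd1, hdD⟩ := mem_Icc.1 hdmem
          have hgd : g ∣ d := hGd ▸ Nat.gcd_dvd_right _ _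
          exact mem_Icc.2 ⟨Nat.div_pos (Nat.le_of_dvd (by omega) hgd) hg1, Nat.div_le_div_right hdD⟩
      _ = ∑ d' ∈ Icc 1 Qg, |∑ m ∈ (Icc 1 (Nb d')).filter (fun m : ℕ => (m : ZMod d') = ab d'),
              (liouville m : ℝ)| + Qg := by
          rw [sum_add_distrib, sum_const, Nat.card_Icc, Nat.add_sub_cancel, nsmul_eq_mul, mul_one]
      _ ≤ Ch * X / Real.log X ^ (A + 1) + D := add_le_add hBVg (by exact_mod_cast Nat.div_le_self D g)
      _ ≤ Ch * 2 ^ (A + 1) * X / L ^ (A + 1) + D := by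
          gcongr ?_ + _
          rw [div_le_div_iff₀ (Real.rpow_pos_of_pos hlogX0 _) (Real.rpow_pos_of_pos hL0 _)]
          calc Ch * X * L ^ (A + 1) = Ch * X * ((L / 2) ^ (A + 1) * 2 ^ (A + 1)) := by
                rw [Real.div_rpow hL0.le zero_le_two,
                  div_mul_cancel₀ _ (ne_of_gt (Real.rpow_pos_of_pos two_pos _))]
            _ ≤ Ch * X * (Real.log X ^ (A + 1) * 2 ^ (A + 1)) :=
                mul_le_mul_of_nonneg_left (mul_le_mul_of_nonneg_right
                  (Real.rpow_le_rpow (by positivity) hlogX (by positivity)) (by positivity)) (by positivity)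
            _ = Ch * 2 ^ (A + 1) * X * Real.log X ^ (A + 1) := by ring
  -- summing over `g`
  have hlogD : Real.log D ≤ L := by
    rcases Nat.eq_zero_or_pos D with h | h
    · rw [h, Nat.cast_zero, Real.log_zero]; exact hL0.le
    · exact Real.log_le_log (by exact_mod_cast h) hDx
  calc ∑ g ∈ Icc 1 D, ∑ d ∈ (Icc 1 D).filter (fun d => G d = g), T d
      ≤ ∑ g ∈ Icc 1 D, (Ch * 2 ^ (A + 1) * (2 * x / g) / L ^ (A + 1) + D) := sum_le_sum hfib
    _ = Ch * 2 ^ (A + 1) * 2 * x / L ^ (A + 1) * ∑ g ∈ Icc 1 D, ((g : ℝ))⁻¹ + D * D := by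
        rw [sum_add_distrib, sum_const, Nat.card_Icc, Nat.add_sub_cancel, nsmul_eq_mul, mul_sum]
        congr 1
        exact sum_congr rfl fun g _ => by ring
    _ ≤ Ch * 2 ^ (A + 1) * 2 * x / L ^ (A + 1) * (2 * L) + x / L ^ A := by
        refine add_le_add (mul_le_mul_of_nonneg_left ?_ (by positivity)) ?_
        · exact (harmonic_Icc_le D).trans (by linarith)
        · rw [le_div_iff₀ (Real.rpow_pos_of_pos hL0 A)]
          calc (D : ℝ) * D * L ^ A ≤ x ^ (1 / 2 - ε) * x ^ (1 / 2 - ε) * x ^ (2 * ε) := by gcongr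
            _ = x := by
                rw [← Real.rpow_add hx0, ← Real.rpow_add hx0]
                conv_rhs => rw [← Real.rpow_one x]
                congr 1; ring
    _ = (4 * 2 ^ (A + 1) * Ch + 1) * x / L ^ A := by
        rw [hLA1]
        have hA0 : L ^ A ≠ 0 := (Real.rpow_pos_of_pos hL0 A).ne'
        field_simp
        ring

/-- Registered stub `stub_bvLiouville` of line `peel-to-drappeau` (crux stmt-Parity-14272): the route item
`BVLiouville`, by `BVLiouville_proof`. [this line] -/
theorem stub_bvLiouville : BVLiouville :=
  BVLiouville_proof

end Summit.Parity.GeneralizedHardyLittlewood.Cruxes.TypeI2Dilated.PeelToDrappeau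

end
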